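import Summits.ResolutionOfSingularities.ResolutionOfSingularities.Theorems.FrobeniusClosingSteerEventualMonomial
import Summits.ResolutionOfSingularities.ResolutionOfSingularities.Theorems.FrobeniusClosingSteerQuadraticStepLemmas
import HarnessLib

/-!
# Crux `Steer` (stmt-ResolutionOfSingularities-16345), line `switching_dichotomy`: GRANJA–MARTÍNEZ–RODRÍGUEZ —
# a divergent sum of exceptional values forces STRONG SWITCHING (and: outside a member for ever ⇒ bounded partial sums)

OURS (campaign `res-hironaka`, rung L ★L-G4, slot W4.1, chain W4.1; seat `res-L0-w41-stub-4` g3; Theses-free helper for the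
holder res-L0-w41-lead-1's line `switching_dichotomy` (skeleton r22) and for res-L0-w41-strat-1's re-cut S0–S3 of the
(α) heart; replaces the role of no printed item; NOT a statement of the manuscript under review [claim: Hironaka2017, status:
under-review]; AI-produced, which is weaker than expert review). Sequel of `FrobeniusClosingSteerEventualMonomial.lean`
(E-1/E-2) and `FrobeniusClosingSteerEventualStep.lean` (E-3/E-4).

## E-5 · the GMR inequality and its two readings

Let `R 0 = (A₀)_{𝔪_O ∩ A₀} ⊆ R 1 ⊆ ⋯` be the point sequence of a base `A₀ ⊆ O` regular at the centre of `O`, and let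
`x i` be exceptional parameters of the members (non-zero elements of the centre of `O` on `R i` of maximal `O`-value, so
that `v (x i) = v (𝔪_i)` multiplicatively).

* **`valuation_le_prod_of_forall_not_mem` (Granja–Martínez–Rodríguez).** If `z = a / w ∈ O` with `a, w ∈ R 0`, `w ≠ 0`,
  lies in NO member, then for every `n`: `v w ≤ ∏_{i<n} v (x i)` — additively `Σ_{i<n} v(𝔪_i) ≤ v(w)`: the partial sums of
  the exceptional values are BOUNDED by the value of a denominator of `z`. Proof: divide numerator and denominator by the
  exceptional parameter at every step — both stay in the maximal ideal (the denominator because `z ∉ R i`, the numerator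
  because `z ∈ O`), so `a / (x 0 ⋯ x (i-1))`, `w / (x 0 ⋯ x (i-1)) ∈ R i` (`div_mem_of_isQuadraticTransformAlong`), and the
  latter has value `≤ 1`.
* **`stronglySwitching_of_divergent`.** Hence if the exceptional values have DIVERGENT sum — every non-zero value is
  undercut by some partial product, `∀ c ≠ 0, ∃ n, ∏_{i<n} v (x i) < v c` — the sequence is STRONGLY SWITCHING: every
  element of `O` which is a fraction of elements of `A₀` lies in some member. This is [GranjaEtAl2007] as quoted in
  [HeinzerOlberdingToeniskoetter2017, Prop. 6.2 (2)] («`s = Σ v(𝔪_i) = ∞` implies `⋃ R_n = V`»; arXiv text Prop. 7.3,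
  [corpus: paper:arxiv-1512.03848 p.3 L72–73, p.14 L142–147]).

## Reading for the chain (with E-4 `exists_isTorsorRun_of_tail`)

ONE numerical invariant of the valuation along the base, `s = Σ_i v(𝔪_i)`, splits the rank-one core of r22:
`s < ∞` ⇒ (E-4, given SS and never-log-final) an ETERNAL affine run exists from every generator at every late stage, so the
datum is caught by the `het` test of `concl_of_phasesSSL` (R2 / `GenRebase`) or, if `¬ SS`, by `NonSwitchingCore`;
`s = ∞` ⇒ (E-5) SS holds AUTOMATICALLY and (HOT 2017 Prop. 6.2 (3)) the rational rank is one — this is the exact home of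
Φ3ᴸˢ / Φ4ᴸˢ / strat-1's S3 `EternalCyclesSS`. In particular `NonSwitchingCore` only ever meets `s < ∞` data and S3 only
`s = ∞` data.

Sources: A. Granja, M. C. Martínez, C. Rodríguez, *Valuations dominating regular local rings and proximity relations*,
J. Pure Appl. Algebra 209 (2007) 371–382; W. Heinzer, B. Olberding, M. Toeniskoetter, *Asymptotic properties of infinite
directed unions of local quadratic transforms*, J. Algebra 479 (2017), Prop. 6.2.
-/

-- `Summit.<S>.<S>.…` duplicates the summit name by design (single-problem summit).
set_option linter.dupNamespace false

open IsLocalRing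
open Literature.AlgebraicGeometry.Resolution

namespace Summit.ResolutionOfSingularities.ResolutionOfSingularities.Theorems.SwitchingDichotomy

namespace EventualMonomial

variable {k K : Type} [Field k] [Field K] [Algebra k K]

/-! ## E-5 · the Granja–Martínez–Rodríguez inequality -/

/-- **GMR inequality.** Along the point sequence `R` of a base `A₀ ⊆ O` regular at the centre, with exceptional
parameters `x i` of the members `R i`: if `z = a / w ∈ O` (`a, w ∈ R 0`, `w ≠ 0`) lies in no member `R i`, then for
every `n` the partial product of exceptional values stays above `v w`: `v w ≤ ∏_{i<n} v (x i)` (additively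
`Σ_{i<n} v(𝔪_i) ≤ v(w)`). [cite: GranjaEtAl2007] [cite: HeinzerOlberdingToeniskoetter2017, Prop. 6.2] -/
theorem valuation_le_prod_of_forall_not_mem (O : ValuationSubring K) (A₀ : Subalgebra k K)
    (h₀ : A₀.toSubring ≤ O.toSubring)
    (hreg : IsRegularLocalRing (Localization.AtPrime
      (Ideal.comap (Subring.inclusion h₀) (IsLocalRing.maximalIdeal O))))
    (R : ℕ → Subring K) (hR0 : R 0 = locAtCentre A₀.toSubring O)
    (hstep : ∀ i, IsQuadraticTransformAlong O (R i) (R (i + 1)))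
    (x : ℕ → K)
    (hx : ∀ i, x i ∈ R i ∧ x i ≠ 0 ∧ O.valuation (x i) < 1 ∧
      ∀ y ∈ R i, O.valuation y < 1 → O.valuation y ≤ O.valuation (x i))
    (a w : K) (ha : a ∈ R 0) (hw : w ∈ R 0) (hw0 : w ≠ 0) (hzO : a / w ∈ O)
    (hnot : ∀ i, a / w ∉ R i) (n : ℕ) :
    O.valuation w ≤ ∏ i ∈ Finset.range n, O.valuation (x i) := by
  classical
  have hreg₀ : IsRegularLocalRing (R 0) := by
    rw [hR0]
    exact (isRegularLocalRing_locAtCentre_iff h₀).mpr hreg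
  haveI hRreg : ∀ i, IsRegularLocalRing (R i) := isRegularLocalRing_sequence hreg₀ hstep
  have hdom₀ : SubringDominates (R 0) O.toSubring := by
    rw [hR0]
    exact subringDominates_locAtCentre h₀
  have hRdom : ∀ i, SubringDominates (R i) O.toSubring := fun i =>
    (sequence_dominates hdom₀ hstep i).1
  have hRO : ∀ i, R i ≤ O.toSubring := fun i => (hRdom i).1
  have hx0 : ∀ i, x i ≠ 0 := fun i => (hx i).2.1
  -- divide numerator and denominator by the exceptional parameter at every step
  let q : ℕ → K := fun j => Nat.rec (motive := fun _ => K) (1 : K) (fun j qj => qj * x j) j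
  have hq0 : q 0 = 1 := rfl
  have hqs : ∀ j, q (j + 1) = q j * x j := fun j => rfl
  have hqne : ∀ j, q j ≠ 0 := by
    intro j
    induction j with
    | zero => rw [hq0]; exact one_ne_zero
    | succ j ih => rw [hqs]; exact mul_ne_zero ih (hx0 j)
  have hqv : ∀ j, O.valuation (q j) = ∏ i ∈ Finset.range j, O.valuation (x i) := by
    intro j
    induction j with
    | zero => rw [hq0, map_one, Finset.prod_range_zero]
    | succ j ih => rw [hqs, map_mul, ih, Finset.prod_range_succ]
  -- invariant: `a / q j ∈ R j` and `w / q j ∈ R j`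
  have hmem : ∀ j, a / q j ∈ R j ∧ w / q j ∈ R j := by
    intro j
    induction j with
    | zero =>
      rw [hq0, div_one, div_one]
      exact ⟨ha, hw⟩
    | succ j ih =>
      obtain ⟨haj, hwj⟩ := ih
      -- the denominator is in the maximal ideal: otherwise `z ∈ R j`
      have hvw : O.valuation (w / q j) < 1 := by
        refine lt_of_le_of_ne ((O.valuation_le_one_iff _).mpr (hRO j hwj)) fun h1 => hnot j ?_
        have hwq0 : w / q j ≠ 0 := div_ne_zero hw0 (hqne j)
        have hinv : (w / q j)⁻¹ ∈ R j :=
          (hRdom j).2 _ hwj ((O.valuation_le_one_iff _).mp (by rw [map_inv₀, h1, inv_one]))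
        have hid : (a / q j) * (w / q j)⁻¹ = a / w := by
          rw [inv_div, div_mul_div_comm, mul_comm a (q j), mul_div_mul_left a w (hqne j)]
        rw [← hid]
        exact Subring.mul_mem _ haj hinv
      -- the numerator is in the maximal ideal: otherwise `v z > 1`
      have hva : O.valuation (a / q j) < 1 := by
        refine lt_of_le_of_ne ((O.valuation_le_one_iff _).mpr (hRO j haj)) fun h1 => ?_
        have hz : O.valuation (a / w) = O.valuation (a / q j) / O.valuation (w / q j) := by
          rw [← map_div₀, div_div_div_cancel_right₀ (hqne j)]
        have hle : O.valuation (a / w) ≤ 1 := (O.valuation_le_one_iff _).mpr hzO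
        rw [hz, h1, one_div] at hle
        have hpos : 0 < O.valuation (w / q j) :=
          (Valuation.pos_iff _).mpr (div_ne_zero hw0 (hqne j))
        have : 1 < (O.valuation (w / q j))⁻¹ := (one_lt_inv₀ hpos).mpr hvw
        exact not_lt.mpr hle this
      refine ⟨?_, ?_⟩
      · rw [hqs, ← div_div]
        exact QuadraticStep.div_mem_of_isQuadraticTransformAlong (hstep j) (hRdom j) (hx j).1 (hx0 j)
          (hx j).2.2.1 (hx j).2.2.2 haj hva
      · rw [hqs, ← div_div]
        exact QuadraticStep.div_mem_of_isQuadraticTransformAlong (hstep j) (hRdom j) (hx j).1 (hx0 j)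
          (hx j).2.2.1 (hx j).2.2.2 hwj hvw
  -- the value of `w / q n ∈ R n ⊆ O` is at most `1`
  have hle : O.valuation (w / q n) ≤ 1 := (O.valuation_le_one_iff _).mpr (hRO n (hmem n).2)
  rw [map_div₀, div_le_one₀ ((Valuation.pos_iff _).mpr (hqne n)), hqv] at hle
  exact hle

/-! ## E-5′ · divergent exceptional values force strong switching -/

/-- **Granja–Martínez–Rodríguez: `Σ v(𝔪_i) = ∞ ⇒ ⋃ R i = O ∩ Frac A₀`.** Along the point sequence `R` of a base
`A₀ ⊆ O` regular at the centre, if the exceptional values have DIVERGENT sum — every non-zero value of `K` is undercut by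
some partial product, `∀ c ≠ 0, ∃ n, ∏_{i<n} v (x i) < v c` — then the sequence is STRONGLY SWITCHING (the skeleton's
`StronglySwitching`, unfolded, for this sequence): every element of `O` that is a fraction of elements of `A₀` lies in
some member. [cite: GranjaEtAl2007] [cite: HeinzerOlberdingToeniskoetter2017, Prop. 6.2] -/
theorem stronglySwitching_of_divergent (O : ValuationSubring K) (A₀ : Subalgebra k K)
    (h₀ : A₀.toSubring ≤ O.toSubring)
    (hreg : IsRegularLocalRing (Localization.AtPrime
      (Ideal.comap (Subring.inclusion h₀) (IsLocalRing.maximalIdeal O))))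
    (R : ℕ → Subring K) (hR0 : R 0 = locAtCentre A₀.toSubring O)
    (hstep : ∀ i, IsQuadraticTransformAlong O (R i) (R (i + 1)))
    (x : ℕ → K)
    (hx : ∀ i, x i ∈ R i ∧ x i ≠ 0 ∧ O.valuation (x i) < 1 ∧
      ∀ y ∈ R i, O.valuation y < 1 → O.valuation y ≤ O.valuation (x i))
    (hdiv : ∀ c : K, c ≠ 0 → ∃ n, (∏ i ∈ Finset.range n, O.valuation (x i)) < O.valuation c) :
    ∀ z : K, z ∈ O → (∃ y ∈ A₀, ∃ w ∈ A₀, w ≠ 0 ∧ z = y / w) → ∃ i, z ∈ R i := by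
  classical
  rintro z hzO ⟨y, hy, w, hw, hw0, rfl⟩
  by_contra hcon
  push Not at hcon
  have hmono : Monotone R := sequence_monotone hstep
  have hA₀R : ∀ a ∈ A₀, a ∈ R 0 := fun a ha => by
    rw [hR0]
    exact le_locAtCentre A₀.toSubring O ha
  obtain ⟨n, hn⟩ := hdiv w hw0
  exact not_lt.mpr
    (valuation_le_prod_of_forall_not_mem O A₀ h₀ hreg R hR0 hstep x hx y w (hA₀R y hy) (hA₀R w hw) hw0 hzO
      hcon n) hn

/-- **Exceptional parameters exist at every member** (from the quadratic steps themselves): a choice function for the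
hypothesis `hx` of the two theorems above. [folklore] -/
theorem exists_excParam_seq (O : ValuationSubring K) (A₀ : Subalgebra k K) (h₀ : A₀.toSubring ≤ O.toSubring)
    (hreg : IsRegularLocalRing (Localization.AtPrime
      (Ideal.comap (Subring.inclusion h₀) (IsLocalRing.maximalIdeal O))))
    (R : ℕ → Subring K) (hR0 : R 0 = locAtCentre A₀.toSubring O)
    (hstep : ∀ i, IsQuadraticTransformAlong O (R i) (R (i + 1))) :
    ∃ x : ℕ → K, ∀ i, x i ∈ R i ∧ x i ≠ 0 ∧ O.valuation (x i) < 1 ∧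
      ∀ y ∈ R i, O.valuation y < 1 → O.valuation y ≤ O.valuation (x i) := by
  classical
  have hreg₀ : IsRegularLocalRing (R 0) := by
    rw [hR0]
    exact (isRegularLocalRing_locAtCentre_iff h₀).mpr hreg
  haveI hRreg : ∀ i, IsRegularLocalRing (R i) := isRegularLocalRing_sequence hreg₀ hstep
  have hdom₀ : SubringDominates (R 0) O.toSubring := by
    rw [hR0]
    exact subringDominates_locAtCentre h₀
  have hRdom : ∀ i, SubringDominates (R i) O.toSubring := fun i =>
    (sequence_dominates hdom₀ hstep i).1
  have hmax : ∀ i (a : R i), a ∈ maximalIdeal (R i) ↔ O.valuation (a : K) < 1 := fun i =>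
    (subringDominates_valuationSubring_iff (hRdom i).1).mp (hRdom i)
  have h : ∀ i, ∃ xi : K, xi ∈ R i ∧ xi ≠ 0 ∧ O.valuation xi < 1 ∧
      ∀ y ∈ R i, O.valuation y < 1 → O.valuation y ≤ O.valuation xi := by
    intro i
    obtain ⟨hloc, xi, hxm, hx0, hval, -⟩ := (hstep i).exists_eq_locAtCentre
    exact ⟨xi, xi.2, fun h => hx0 (Subtype.ext h), (hmax i xi).mp hxm,
      fun y hy hvy => hval ⟨y, hy⟩ ((hmax i ⟨y, hy⟩).mpr hvy)⟩
  exact ⟨fun i => (h i).choose, fun i => (h i).choose_spec⟩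

end EventualMonomial

end Summit.ResolutionOfSingularities.ResolutionOfSingularities.Theorems.SwitchingDichotomy
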